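import Mathlib
import Summits.ResolutionOfSingularities.ResolutionOfSingularities.Theorems.RadicialJungCleanModelsCleanLU3CompositePersistFibre
import HarnessLib

/-!
# Route `RadicialJung`, crux `CleanModels` (stmt-15917), stub `stub_cleanLU3DefectNonDiscrete`, sub-line (C-div): STUBS `stub_persistE1` and
# `stub_persistE2` (workfile `Lines/Sketch_Cdiv_assembly.lean` v3 §PersistV3, registered shapes :153 / :168)

Lead `res-B-lead-1` g5; E1 core in `κ(S)[X]` by the critic `res-B-crit-1` g5 (`w5_helpers.lean`), statements confirmed TRIAGE-84.  OURS;
nothing here proves resolution in characteristic `p`.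

**First-order `p`-th-power facts after one quadratic transform `S ⊂ S'` along `Ō` in dimension two.**  Both are read in the chart
`B = S[𝔪/σ]` of a minimal-value generator through ✓ `persistFibre` (`…CompositePersistFibre.lean`): `S' = B_𝔔`, the chart map
`Φ : B ↠ κ(S)[X]` (`s ↦ s̄`, `τ/σ ↦ X`), a prime `P` with `𝔔 = Φ⁻¹(P)`, and the reduction
`θ − (g/t)^p ∈ 𝔪_{S'}² ⟹ P² ∣ Φ(t)^p Φ(θ) − Φ(g)^p`, `P ∤ Φ(t)`.
* E1 (`stub_persistE1`): `θ = ε (y₁/x₁)^b`, `p ∤ b`, `θ` a unit ⟹ `Φ θ = ε̄ X^b` with `P ∤ X`; differentiate in `X`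
  (`dvd_of_sq_dvd_frobenius_form`): `P ∣ Φ t`, absurd.
* E2 (`stub_persistE2`): `θ = ε` with `ε̄ ∉ κ(S)^p`, moved by a derivation `D` of `κ(S)` (`hDer`) ⟹ apply `D` coefficientwise
  (Mathlib `Differential.mapCoeffs`; `dvd_of_sq_dvd_frobenius_const`): `P ∣ Φ(t)^p·D(ε̄)`, absurd.
-/

noncomputable section

set_option linter.dupNamespace false -- mandated namespace of this single-conjunct summit

open IsLocalRing
open Literature.AlgebraicGeometry.Resolution

namespace Summit.ResolutionOfSingularities.ResolutionOfSingularities.Theorems.RadicialJung.CleanModels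

section PersistE

open Polynomial

variable {F : Type*} [Field F]

/-- If `P² ∣ N` then `P ∣ N'` (`(P²h)' = 2PP'h + P²h'`; no separability needed).  [critic res-B-crit-1 g5, `w5_helpers.lean`] [folklore] -/
theorem dvd_derivative_of_sq_dvd' {P N : F[X]} (h : P ^ 2 ∣ N) : P ∣ derivative N := by
  obtain ⟨h, rfl⟩ := h
  rw [derivative_mul, derivative_sq]
  exact dvd_add (dvd_mul_of_dvd_left (dvd_mul_of_dvd_left (dvd_mul_left P (C 2)) _) _)
    (dvd_mul_of_dvd_left (dvd_pow_self P two_ne_zero) _)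

/-- An irreducible polynomial does not divide a nonzero constant. [folklore] -/
theorem irreducible_not_dvd_C' {P : F[X]} (hP : Irreducible P) {c : F} (hc : c ≠ 0) : ¬ P ∣ C c :=
  fun h => hP.not_isUnit (isUnit_of_dvd_unit h (isUnit_C.mpr (Ne.isUnit hc)))

/-- **E1 core in `κ(S)[X]`** (critic res-B-crit-1 g5): `P` irreducible, `P ∤ X`, `a ≠ 0`, `p ∤ b` and `P² ∣ t^p·(a X^b) − g^p` in
characteristic `p` ⟹ `P ∣ t` (differentiate: the `p`-th powers die). [folklore] -/
theorem dvd_of_sq_dvd_frobenius_form (p : ℕ) [Fact p.Prime] [CharP F p] {P t g : F[X]} (hP : Irreducible P) (hPX : ¬ P ∣ X)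
    {a : F} (ha : a ≠ 0) {b : ℕ} (hb : ¬ p ∣ b) (h : P ^ 2 ∣ t ^ p * (C a * X ^ b) - g ^ p) : P ∣ t := by
  have hd := dvd_derivative_of_sq_dvd' h
  have hder : derivative (t ^ p * (C a * X ^ b) - g ^ p) = t ^ p * (C (a * b) * X ^ (b - 1)) := by
    rw [derivative_sub, derivative_mul, derivative_pow, derivative_pow, derivative_C_mul_X_pow]
    simp [C_mul]
  rw [hder] at hd
  have hb' : (b : F) ≠ 0 := by rwa [Ne, CharP.cast_eq_zero_iff F p]
  have hab : a * b ≠ 0 := mul_ne_zero ha hb'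
  rcases hP.prime.dvd_or_dvd hd with h1 | h2
  · exact hP.prime.dvd_of_dvd_pow h1
  · exfalso
    have h3 : P ∣ X ^ (b - 1) :=
      (hP.prime.dvd_or_dvd h2).resolve_left (irreducible_not_dvd_C' hP hab)
    exact hPX (hP.prime.dvd_of_dvd_pow h3)

/-- **E2 core in `κ(S)[X]`**: `P` irreducible, `D` a derivation of the coefficient field with `D a ≠ 0`, and `P² ∣ t^p·a − g^p` in
characteristic `p` ⟹ `P ∣ t` (apply `D` coefficientwise: the `p`-th powers die, `X` is a constant). [folklore] -/
theorem dvd_of_sq_dvd_frobenius_const (p : ℕ) [Fact p.Prime] [CharP F p] {P t g : F[X]} (hP : Irreducible P)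
    (D : Derivation ℤ F F) {a : F} (ha : D a ≠ 0) (h : P ^ 2 ∣ t ^ p * C a - g ^ p) : P ∣ t := by
  letI : Differential F := ⟨D⟩
  have hDC : ∀ c : F, Differential.mapCoeffs (C c) = C (D c) := fun c => Differential.mapCoeffs_C c
  have hDp : ∀ f : F[X], Differential.mapCoeffs (f ^ p) = 0 := fun f => by
    rw [Differential.mapCoeffs.leibniz_pow, nsmul_eq_mul, CharP.cast_eq_zero, zero_mul]
  obtain ⟨q, hq⟩ := h
  have hD1 : Differential.mapCoeffs (t ^ p * C a - g ^ p) = t ^ p * C (D a) := by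
    have e1 : Differential.mapCoeffs (t ^ p * C a) = t ^ p * C (D a) := by
      have := Differential.mapCoeffs.leibniz (t ^ p) (C a)
      rw [hDp t, hDC a, smul_eq_mul, smul_zero, add_zero] at this
      exact this
    have e2 : Differential.mapCoeffs (t ^ p * C a - g ^ p) =
        Differential.mapCoeffs (t ^ p * C a) - Differential.mapCoeffs (g ^ p) := map_sub _ _ _
    rw [e2, e1, hDp g, sub_zero]
  have hD2 : P ∣ Differential.mapCoeffs (P ^ 2 * q) := by
    have e : Differential.mapCoeffs (P ^ 2 * q) =
        P * (P * Differential.mapCoeffs q + 2 * Differential.mapCoeffs P * q) := by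
      rw [pow_two, Differential.mapCoeffs.leibniz, Differential.mapCoeffs.leibniz]
      simp only [smul_eq_mul]
      ring
    rw [e]; exact dvd_mul_right P _
  rw [← hq, hD1] at hD2
  rcases hP.prime.dvd_or_dvd hD2 with h1 | h2
  · exact hP.prime.dvd_of_dvd_pow h1
  · exact absurd h2 (irreducible_not_dvd_C' hP ha)

variable {κ' : Type} [Field κ']

/-- In a linearly ordered value group with zero, `b`-th powers (`b ≠ 0`) are injective. [folklore] -/
theorem valuation_eq_of_pow_eq {Γ₀ : Type*} [LinearOrderedCommGroupWithZero Γ₀] {a c : Γ₀} {n : ℕ} (hn : n ≠ 0)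
    (h : a ^ n = c ^ n) : a = c := by
  rcases lt_trichotomy a c with hlt | heq | hgt
  · exact absurd h (ne_of_lt (pow_lt_pow_left₀ hlt zero_le hn))
  · exact heq
  · exact absurd h.symm (ne_of_lt (pow_lt_pow_left₀ hgt zero_le hn))

/-- The residue field of a local subring of a field of characteristic `p` has characteristic `p`. [folklore] -/
theorem charP_residueField_subring (p : ℕ) [hp : Fact p.Prime] {κ : Type} [Field κ] [CharP κ p] (S : Subring κ) [IsLocalRing S] :
    CharP (ResidueField S) p := by
  refine (CharP.charP_iff_prime_eq_zero hp.out).2 ?_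
  have hpS : (p : S) = 0 := by
    apply Subtype.ext
    rw [Subring.coe_natCast]
    exact CharP.cast_eq_zero κ p
  rw [← map_natCast (residue S), hpS, map_zero]

/-- **STUB E1** (workfile `Lines/Sketch_Cdiv_assembly.lean` v3 :153, registered shape): a unit `θ = ε·(y₁/x₁)^b` of `S'` with `p ∤ b` is
congruent to a `p`-th power at most to first order: `θ − γ^p ∉ 𝔪_{S'}²`.  Proof: `persistFibre` in the chart of `x₁` (of minimal value
because `θ`, `ε` are units) and the E1 core in `κ(S)[X]`. [folklore] -/
theorem stub_persistE1 :
    ∀ (p : ℕ) [Fact p.Prime] (κ : Type) [Field κ] [CharP κ p]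
    (Ō : ValuationSubring κ) (S S' : Subring κ) [IsRegularLocalRing S] [IsRegularLocalRing S'],
    ringKrullDim S = 2 → ringKrullDim S' = 2 → IsLocalRingOf S → IsQuadraticTransformAlong Ō S S' →
    SubringDominates S Ō.toSubring →
    ∀ (x₁ y₁ : S), maximalIdeal S = Ideal.span {x₁, y₁} →
    ∀ (ε : S), IsUnit ε → ∀ (b : ℕ), ¬ p ∣ b →
    ∀ (θ : S'), IsUnit θ → (θ : κ) * (x₁ : κ) ^ b = (ε : κ) * (y₁ : κ) ^ b →
    ∀ γ : S', θ - γ ^ p ∉ maximalIdeal S' ^ 2 := by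
  intro p _ κ _ _ Ō S S' _ _ hdimS hdimS' _ hqt hdom x₁ y₁ hm ε hε b hpb θ hθ hθeq γ hsq
  haveI := charP_residueField_subring p S
  have hb0 : b ≠ 0 := by rintro rfl; exact hpb (dvd_zero p)
  have hvθ : Ō.valuation (θ : κ) = 1 := (isUnit_qt_iff hqt θ).mp hθ
  have hvε : Ō.valuation (ε : κ) = 1 := (isUnit_iff_of_dominates hdom ε).mp hε
  have hε0 : (ε : κ) ≠ 0 := ne_zero_of_valuation_eq_one hvε
  have hεm : ε ∉ maximalIdeal S := fun h => (IsLocalRing.mem_maximalIdeal _ |>.mp h) hε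
  have hεres : residue S ε ≠ 0 := by rwa [Ne, IsLocalRing.residue_eq_zero_iff]
  -- `v x₁ = v y₁`
  have hvxy : Ō.valuation (x₁ : κ) = Ō.valuation (y₁ : κ) := by
    have h1 := congrArg Ō.valuation hθeq
    rw [map_mul, map_mul, map_pow, map_pow, hvθ, hvε, one_mul, one_mul] at h1
    exact valuation_eq_of_pow_eq hb0 h1
  have hmax : ∀ z ∈ maximalIdeal S, Ō.valuation (z : κ) ≤ Ō.valuation (x₁ : κ) := by
    rcases exists_max_valuation_gen Ō S hdom.1 x₁ y₁ hm with h | h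
    · exact h
    · intro z hz; rw [hvxy]; exact h z hz
  obtain ⟨hBS', Φ, P, -, hP, hΦC, hΦX, -, heq1, hfrac, hred⟩ :=
    persistFibre p Ō S S' hdimS hdimS' hqt hdom x₁ y₁ hm hmax
  have hx0 : (x₁ : κ) ≠ 0 := by
    intro h
    obtain ⟨_, x, hxm, hx0, -, -⟩ := hqt.exists_eq_locAtCentre
    have h1 := hmax x hxm
    rw [h, map_zero, le_zero_iff, map_eq_zero] at h1
    exact hx0 (Subtype.ext h1)
  have hy0 : (y₁ : κ) ≠ 0 := by
    intro h; rw [h, map_zero] at hvxy; exact hx0 ((map_eq_zero Ō.valuation).mp hvxy)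
  have hy₁m : y₁ ∈ maximalIdeal S := by rw [hm]; exact Ideal.subset_span (by simp)
  set w : κ := ((y₁ : S) : κ) / (x₁ : κ) with hw
  have hwB : w ∈ blowupRing S (x₁ : κ) := div_mem_blowupRing _ hy₁m
  have hvw : Ō.valuation w = 1 := by
    rw [hw, map_div₀, hvxy, div_self]
    exact (_root_.map_ne_zero _).mpr hy0
  have hPX : ¬ P ∣ X := by rw [← hΦX hwB]; exact (heq1 ⟨w, hwB⟩).mp hvw
  -- `θ = ε w^b` as an element of `B`
  set θB : blowupRing S (x₁ : κ) := ⟨(ε : κ), le_blowupRing _ _ ε.2⟩ * ⟨w, hwB⟩ ^ b with hθB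
  have hθBκ : (θB : κ) = (θ : κ) := by
    rw [hθB]; push_cast
    simp only [hw]
    rw [div_pow, ← mul_div_assoc, ← hθeq, mul_div_assoc, div_self (pow_ne_zero _ hx0), mul_one]
  obtain ⟨g, hg, t, ht, hvt, hγ⟩ := hfrac (γ : κ) γ.2
  have hmem : (θB : κ) - (((⟨g, hg⟩ : blowupRing S (x₁ : κ)) : κ) / ((⟨t, ht⟩ : blowupRing S (x₁ : κ)) : κ)) ^ p ∈ S' := by
    have e : (θB : κ) - (g / t) ^ p = ((θ - γ ^ p : S') : κ) := by push_cast; rw [hθBκ, hγ]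
    show (θB : κ) - (g / t) ^ p ∈ S'
    rw [e]; exact (θ - γ ^ p).2
  have hsq' : (⟨_, hmem⟩ : S') ∈ maximalIdeal S' ^ 2 := by
    have e : (⟨_, hmem⟩ : S') = θ - γ ^ p := Subtype.ext (by push_cast; rw [hθBκ, hγ])
    rw [e]; exact hsq
  have hdiv := hred θB ⟨g, hg⟩ ⟨t, ht⟩ hvt hmem hsq'
  have hΦθ : Φ θB = C (residue S ε) * X ^ b := by rw [hθB, map_mul, map_pow, hΦC, hΦX]
  rw [hΦθ] at hdiv
  have hPt : P ∣ Φ ⟨t, ht⟩ := dvd_of_sq_dvd_frobenius_form p hP.irreducible hPX hεres hpb hdiv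
  exact ((heq1 ⟨t, ht⟩).mp hvt) hPt

/-- **STUB E2** (workfile `Lines/Sketch_Cdiv_assembly.lean` v3 :168, registered shape): a unit `ε` of `S` whose residue is not a `p`-th
power is congruent to a `p`-th power at most to first order in `S'`: `ε − γ^p ∉ 𝔪_{S'}²`, given `hDer` (every non-`p`-th power of
`κ(S)` is moved by a derivation).  Proof: `persistFibre` in the chart of a minimal-value generator and the E2 core. [folklore] -/
theorem stub_persistE2 :
    ∀ (p : ℕ) [Fact p.Prime] (κ : Type) [Field κ] [CharP κ p]
    (Ō : ValuationSubring κ) (S S' : Subring κ) [IsRegularLocalRing S] [IsRegularLocalRing S'],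
    ringKrullDim S = 2 → ringKrullDim S' = 2 → IsLocalRingOf S → IsQuadraticTransformAlong Ō S S' →
    SubringDominates S Ō.toSubring →
    (∀ a : ResidueField S, (∀ b : ResidueField S, b ^ p ≠ a) →
      ∃ D : Derivation ℤ (ResidueField S) (ResidueField S), D a ≠ 0) →
    ∀ (ε : S), (∀ b : S, ε - b ^ p ∉ maximalIdeal S) →
    ∀ (θ : S'), (θ : κ) = (ε : κ) →
    ∀ γ : S', θ - γ ^ p ∉ maximalIdeal S' ^ 2 := by
  intro p _ κ _ _ Ō S S' _ _ hdimS hdimS' _ hqt hdom hDer ε hε θ hθ γ hsq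
  haveI := charP_residueField_subring p S
  -- the residue of `ε` is not a `p`-th power; a derivation moving it
  have hεres : ∀ b : ResidueField S, b ^ p ≠ residue S ε := by
    intro b hb
    obtain ⟨b', rfl⟩ := IsLocalRing.residue_surjective b
    apply hε b'
    rw [← IsLocalRing.residue_eq_zero_iff, map_sub, map_pow, ← hb, sub_self]
  obtain ⟨D, hD⟩ := hDer _ hεres
  -- an r.s.p. with its minimal-value generator first
  obtain ⟨σ, τ, hm, hmax⟩ : ∃ σ τ : S, maximalIdeal S = Ideal.span {σ, τ} ∧
      ∀ z ∈ maximalIdeal S, Ō.valuation (z : κ) ≤ Ō.valuation (σ : κ) := by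
    obtain ⟨a, c, hm', -, -, -, -⟩ := exists_maximalIdeal_eq_span_pair (R := S) hdimS
    rcases exists_max_valuation_gen Ō S hdom.1 a c hm' with h | h
    · exact ⟨a, c, hm', h⟩
    · exact ⟨c, a, by rw [hm', Set.pair_comm], h⟩
  obtain ⟨hBS', Φ, P, -, hP, hΦC, -, -, heq1, hfrac, hred⟩ :=
    persistFibre p Ō S S' hdimS hdimS' hqt hdom σ τ hm hmax
  set θB : blowupRing S (σ : κ) := ⟨(ε : κ), le_blowupRing _ _ ε.2⟩ with hθB
  have hθBκ : (θB : κ) = (θ : κ) := by rw [hθB, hθ]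
  obtain ⟨g, hg, t, ht, hvt, hγ⟩ := hfrac (γ : κ) γ.2
  have hmem : (θB : κ) - (((⟨g, hg⟩ : blowupRing S (σ : κ)) : κ) / ((⟨t, ht⟩ : blowupRing S (σ : κ)) : κ)) ^ p ∈ S' := by
    have e : (θB : κ) - (g / t) ^ p = ((θ - γ ^ p : S') : κ) := by push_cast; rw [hθBκ, hγ]
    show (θB : κ) - (g / t) ^ p ∈ S'
    rw [e]; exact (θ - γ ^ p).2
  have hsq' : (⟨_, hmem⟩ : S') ∈ maximalIdeal S' ^ 2 := by
    have e : (⟨_, hmem⟩ : S') = θ - γ ^ p := Subtype.ext (by push_cast; rw [hθBκ, hγ])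
    rw [e]; exact hsq
  have hdiv := hred θB ⟨g, hg⟩ ⟨t, ht⟩ hvt hmem hsq'
  rw [hθB, hΦC] at hdiv
  have hPt : P ∣ Φ ⟨t, ht⟩ := dvd_of_sq_dvd_frobenius_const p hP.irreducible D hD hdiv
  exact ((heq1 ⟨t, ht⟩).mp hvt) hPt

end PersistE

end Summit.ResolutionOfSingularities.ResolutionOfSingularities.Theorems.RadicialJung.CleanModels

end
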